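import Mathlib
import Literature.Analysis.Convexity.OpenHPolytope
import Literature.Analysis.Convexity.AnisotropicPerimeterPatches
import Literature.Analysis.Convexity.AnisotropicPerimeterPolytopePrism
import Literature.Analysis.Convexity.AnisotropicPerimeterPolytopeUpper
import Literature.Analysis.Convexity.AnisotropicPerimeterPolytopeCutoffs
import Literature.Analysis.Convexity.AnisotropicPerimeterComplement
import Literature.MeasureTheory.Integral.HPolytopeGaussGreen
import Literature.MeasureTheory.Integral.EuclideanDivergenceCoords
import HarnessLib

/-!
# Gauss–Green and the facet formula for OPEN `H`-polytopes of `ℝ³` (open-facet / inner-product form)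

Topic `Literature/MeasureTheory/Integral`; namespace `Literature.MeasureTheory.Integral`.  For a bounded
nonempty open polytope `Q = ⋂_{c ∈ J} {⟪c.1, x⟫ < c.2}` of `EuclideanSpace ℝ (Fin 3)` (unit, pairwise
non-proportional constraints; isometric facet charts `Φ_c y = c.2 • c.1 + y₁ U_c + y₂ V_c`):
`setIntegral_fieldDivergence_openHPolytope_eq_facetSum` (`∫_Q div η = Σ_c ∫_{Φ_c⁻¹(open facet c)} ⟪η∘Φ_c, c.1⟫`,
from the facet-chart theorem `setIntegral_divergence_hPolytope_eq_facetSum`), the chart lemmas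
`volume_chartPreimage_plane_eq_zero` (non-proportional planes are null in a chart),
`chartPreimage_closedHPolytope_ae_eq_openFacet`, `isCompact_chartPreimage`, `measurableSet_openFacet`, and
`anisotropicPerimeter_openHPolytope_eq_facetSum` — **`P_K(Q) = Σ_c h_K(c.1)·|Φ_c⁻¹(open facet c)|`** via the
patch theorem `anisotropicPerimeter_eq_facetSum_of_patches`.  Consumer: unions of open polytopes and
`stub_polytopeCalculus` of stmt-Ventures-19483 (cell `crystal3d-full`).
[cite: EvansGariepy2015, Thm 5.16 (Gauss–Green), polyhedral case; Maggi2012, (20.2) p. 258 and Remark 20.3]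
-/

noncomputable section

namespace Literature.MeasureTheory.Integral

open _root_.MeasureTheory Set
open scoped RealInnerProductSpace
open Literature.MathematicalPhysics.StatisticalMechanics (fieldDivergence)
open Literature.Analysis.Convexity

/-- The coordinate chart read in `EuclideanSpace`. [cite: EvansGariepy2015, Thm 5.16 — plumbing] -/
theorem toLp_chart_eq (c : EuclideanSpace ℝ (Fin 3) × ℝ) (U V : EuclideanSpace ℝ (Fin 3)) (y : ℝ × ℝ) :
    (WithLp.toLp 2 ((fun l => c.2 * c.1 l) + y.1 • (fun l => U l) + y.2 • (fun l => V l)) :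
      EuclideanSpace ℝ (Fin 3)) = c.2 • c.1 + y.1 • U + y.2 • V := by
  ext l
  simp [smul_eq_mul]

/-- **Gauss–Green for a bounded nonempty OPEN `H`-polytope in `ℝ³`, inner-product / open-facet form.**
For `Q = ⋂_{c ∈ J} {⟪c.1, x⟫ < c.2}` nonempty and bounded, with unit and pairwise non-proportional
constraints, isometric facet charts `Φ_c y = c.2 • c.1 + y₁ U_c + y₂ V_c` (`(U_c, V_c, c.1)` orthonormal)
and a `C¹` field `η`:
`∫_Q div η = Σ_{c ∈ J} ∫_{Φ_c⁻¹(open facet c)} ⟪η(Φ_c y), c.1⟫ dy`, the open facet being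
`{⟪c.1, x⟫ = c.2, ⟪c'.1, x⟫ < c'.2 (c' ≠ c)}` (it differs from the closed facet by null tie lines).
[cite: EvansGariepy2015, Thm 5.16 (Gauss–Green), polyhedral case] -/
theorem setIntegral_fieldDivergence_openHPolytope_eq_facetSum
    (J : Finset (EuclideanSpace ℝ (Fin 3) × ℝ)) (h1 : ∀ c ∈ J, ‖c.1‖ = 1)
    (hnd : ∀ c ∈ J, ∀ c' ∈ J, c ≠ c' → ¬ ∃ μ : ℝ, c'.1 = μ • c.1 ∧ c'.2 = μ * c.2)
    (hne : (⋂ c ∈ J, {x : EuclideanSpace ℝ (Fin 3) | ⟪c.1, x⟫ < c.2}).Nonempty)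
    (hbd : Bornology.IsBounded (⋂ c ∈ J, {x : EuclideanSpace ℝ (Fin 3) | ⟪c.1, x⟫ < c.2}))
    (U V : EuclideanSpace ℝ (Fin 3) × ℝ → EuclideanSpace ℝ (Fin 3))
    (hU1 : ∀ c ∈ J, ‖U c‖ = 1) (hV1 : ∀ c ∈ J, ‖V c‖ = 1) (hUV : ∀ c ∈ J, ⟪U c, V c⟫ = 0)
    (haU : ∀ c ∈ J, ⟪c.1, U c⟫ = 0) (haV : ∀ c ∈ J, ⟪c.1, V c⟫ = 0)
    {η : EuclideanSpace ℝ (Fin 3) → EuclideanSpace ℝ (Fin 3)} (hη : ContDiff ℝ 1 η) :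
    ∫ x in ⋂ c ∈ J, {x : EuclideanSpace ℝ (Fin 3) | ⟪c.1, x⟫ < c.2}, fieldDivergence η x =
      ∑ c ∈ J, ∫ y in (fun y : ℝ × ℝ => c.2 • c.1 + y.1 • U c + y.2 • V c) ⁻¹'
          {x | ⟪c.1, x⟫ = c.2 ∧ ∀ c' ∈ J, c' ≠ c → ⟪c'.1, x⟫ < c'.2},
        ⟪η (c.2 • c.1 + y.1 • U c + y.2 • V c), c.1⟫ := by
  classical
  letI : LinearOrder (EuclideanSpace ℝ (Fin 3) × ℝ) := WellOrderingRel.isWellOrder.linearOrder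
  set Q : Set (EuclideanSpace ℝ (Fin 3)) := ⋂ c ∈ J, {x | ⟪c.1, x⟫ < c.2} with hQ
  set P : Set (EuclideanSpace ℝ (Fin 3)) := ⋂ c ∈ J, {x | ⟪c.1, x⟫ ≤ c.2} with hP
  have hcl : closure Q = P := closure_openHPolytope_eq J hne
  have hPc : IsCompact P := isCompact_closedHPolytope_of_isBounded J hne hbd
  -- Step 1: the open polytope and its closure carry the same integrals
  have hae : (Q : Set (EuclideanSpace ℝ (Fin 3))) =ᵐ[volume] P := by
    rw [← hcl]; exact (closure_ae_eq_of_convex' (convex_openHPolytope J)).symm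
  rw [setIntegral_congr_set hae]
  -- Step 2: coordinates for the facet-chart Gauss–Green theorem
  obtain ⟨a, ha⟩ : ∃ a : (EuclideanSpace ℝ (Fin 3) × ℝ) → Fin 3 → ℝ, a = fun c l => c.1 l := ⟨_, rfl⟩
  obtain ⟨b, hb⟩ : ∃ b : (EuclideanSpace ℝ (Fin 3) × ℝ) → ℝ, b = fun c => c.2 := ⟨_, rfl⟩
  obtain ⟨pF, hpF⟩ : ∃ pF : (EuclideanSpace ℝ (Fin 3) × ℝ) → Fin 3 → ℝ,
    pF = fun c l => c.2 * c.1 l := ⟨_, rfl⟩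
  obtain ⟨UF, hUF⟩ : ∃ UF : (EuclideanSpace ℝ (Fin 3) × ℝ) → Fin 3 → ℝ, UF = fun c l => U c l :=
    ⟨_, rfl⟩
  obtain ⟨VF, hVF⟩ : ∃ VF : (EuclideanSpace ℝ (Fin 3) × ℝ) → Fin 3 → ℝ, VF = fun c l => V c l :=
    ⟨_, rfl⟩
  have hP' : (WithLp.toLp 2 : (Fin 3 → ℝ) → EuclideanSpace ℝ (Fin 3)) ⁻¹' P =
      {x : Fin 3 → ℝ | ∀ c ∈ J, ∑ l, a c l * x l ≤ b c} := by
    ext x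
    simp only [hP, ha, hb, mem_preimage, mem_iInter, mem_setOf_eq, inner_eq_sum_mul_three]
  have hPimage : (WithLp.toLp 2 : (Fin 3 → ℝ) → EuclideanSpace ℝ (Fin 3)) ⁻¹' P =
      (WithLp.ofLp : EuclideanSpace ℝ (Fin 3) → Fin 3 → ℝ) '' P := by
    ext x
    constructor
    · intro hx; exact ⟨WithLp.toLp 2 x, hx, rfl⟩
    · rintro ⟨z, hz, rfl⟩; simpa using hz
  have hPc' : IsCompact {x : Fin 3 → ℝ | ∀ c ∈ J, ∑ l, a c l * x l ≤ b c} := by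
    rw [← hP', hPimage]; exact hPc.image (PiLp.continuous_ofLp 2 _)
  have hPne' : {x : Fin 3 → ℝ | ∀ c ∈ J, ∑ l, a c l * x l ≤ b c}.Nonempty := by
    obtain ⟨x₀, hx₀⟩ := hne
    refine ⟨WithLp.ofLp x₀, ?_⟩
    rw [← hP']
    show WithLp.toLp 2 (WithLp.ofLp x₀) ∈ P
    rw [WithLp.toLp_ofLp]
    exact openHPolytope_subset_closedHPolytope J hx₀
  have hbd' := fun i => filter_sign_nonempty_of_isCompact a b hPc' hPne' i
  have ha1 : ∀ c ∈ J, ∑ l, a c l ^ 2 = 1 := by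
    intro c hc; rw [ha]; simp only; rw [← norm_sq_eq_sum_sq_coord, h1 c hc, one_pow]
  have hnd' : ∀ j ∈ J, ∀ k ∈ J, j ≠ k → ¬ ∃ μ : ℝ, (∀ l, a k l = μ * a j l) ∧ b k = μ * b j := by
    intro j hj k hk hjk ⟨μ, hμ, hμb⟩
    refine hnd j hj k hk hjk ⟨μ, ?_, ?_⟩
    · ext l; simpa [ha] using hμ l
    · simpa [hb] using hμb
  have hp : ∀ c ∈ J, ∑ l, a c l * pF c l = b c := by
    intro c hc
    have : ∑ l, a c l * pF c l = c.2 * ∑ l, a c l ^ 2 := by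
      rw [Finset.mul_sum]; refine Finset.sum_congr rfl fun l _ => ?_; rw [hpF, ha]; ring
    rw [this, ha1 c hc, mul_one, hb]
  have hU : ∀ c ∈ J, ∑ l, a c l * UF c l = 0 := by
    intro c hc; rw [ha, hUF]; simp only; rw [← inner_eq_sum_mul_three]; exact haU c hc
  have hV : ∀ c ∈ J, ∑ l, a c l * VF c l = 0 := by
    intro c hc; rw [ha, hVF]; simp only; rw [← inner_eq_sum_mul_three]; exact haV c hc
  have hU1' : ∀ c ∈ J, ∑ l, UF c l ^ 2 = 1 := by
    intro c hc; rw [hUF]; simp only; rw [← norm_sq_eq_sum_sq_coord, hU1 c hc, one_pow]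
  have hV1' : ∀ c ∈ J, ∑ l, VF c l ^ 2 = 1 := by
    intro c hc; rw [hVF]; simp only; rw [← norm_sq_eq_sum_sq_coord, hV1 c hc, one_pow]
  have hUV' : ∀ c ∈ J, ∑ l, UF c l * VF c l = 0 := by
    intro c hc; rw [hUF, hVF]; simp only; rw [← inner_eq_sum_mul_three]; exact hUV c hc
  -- Step 3: Gauss–Green in coordinates
  rw [setIntegral_fieldDivergence_eq_coords, hP',
    setIntegral_divergence_hPolytope_eq_facetSum a b ha1 hbd' hnd' pF UF VF hp hU hV hU1' hV1' hUV'
      hPc' (η := fun i x => (η (WithLp.toLp 2 x)) i)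
      (dη := fun i x => (fderiv ℝ η (WithLp.toLp 2 x) (EuclideanSpace.single i 1)) i)
      (fun i => continuous_apply_toLp hη.continuous i)
      (fun i => continuous_fderiv_apply_toLp hη i) (fun i x => hasDerivAt_apply_toLp_update hη i x)]
  refine Finset.sum_congr rfl fun c hc => ?_
  -- Step 4: the `c`-th facet: chart dictionary
  have hΦ : ∀ y : ℝ × ℝ, (WithLp.toLp 2 (pF c + y.1 • UF c + y.2 • VF c) : EuclideanSpace ℝ (Fin 3)) =
      c.2 • c.1 + y.1 • U c + y.2 • V c := by
    intro y; rw [hpF, hUF, hVF]; exact toLp_chart_eq c (U c) (V c) y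
  have hmemP : ∀ y : ℝ × ℝ, pF c + y.1 • UF c + y.2 • VF c ∈
      {x : Fin 3 → ℝ | ∀ c ∈ J, ∑ l, a c l * x l ≤ b c} ↔ c.2 • c.1 + y.1 • U c + y.2 • V c ∈ P := by
    intro y; rw [← hP', mem_preimage, hΦ]
  set S : Set (ℝ × ℝ) := (fun y : ℝ × ℝ => c.2 • c.1 + y.1 • U c + y.2 • V c) ⁻¹' P with hS
  have hΦc : Continuous fun y : ℝ × ℝ => c.2 • c.1 + y.1 • U c + y.2 • V c := by fun_prop
  have hSclosed : IsClosed S := hPc.isClosed.preimage hΦc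
  have hSmeas : MeasurableSet S := hSclosed.measurableSet
  have hS' : S = {y : ℝ × ℝ | pF c + y.1 • UF c + y.2 • VF c ∈
      {x : Fin 3 → ℝ | ∀ c ∈ J, ∑ l, a c l * x l ≤ b c}} := by
    ext y; rw [hS, mem_preimage, mem_setOf_eq, hmemP]
  obtain ⟨R, hR⟩ : ∃ R, ∀ x ∈ {x : Fin 3 → ℝ | ∀ c ∈ J, ∑ l, a c l * x l ≤ b c}, ‖x‖ ≤ R := by
    obtain ⟨R, hR⟩ := hPc'.isBounded.subset_closedBall 0
    exact ⟨R, fun x hx => by simpa using hR hx⟩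
  have hSbdd : Bornology.IsBounded S := by
    rw [hS']
    exact (Metric.isBounded_closedBall).subset
      (chartPreimage_subset_closedBall hR (pF c) (UF c) (VF c) (hU1' c hc) (hV1' c hc) (hUV' c hc))
  have hScpt : IsCompact S := Metric.isCompact_of_isClosed_isBounded hSclosed hSbdd
  -- integrability of the facet integrands
  have hfi : ∀ i, Integrable (fun y : ℝ × ℝ =>
      {x : Fin 3 → ℝ | ∀ c ∈ J, ∑ l, a c l * x l ≤ b c}.indicator (fun _ => (1 : ℝ))
        (pF c + y.1 • UF c + y.2 • VF c) *
      (η (WithLp.toLp 2 (pF c + y.1 • UF c + y.2 • VF c))) i) := by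
    intro i
    have hind : (fun y : ℝ × ℝ =>
        {x : Fin 3 → ℝ | ∀ c ∈ J, ∑ l, a c l * x l ≤ b c}.indicator (fun _ => (1 : ℝ))
          (pF c + y.1 • UF c + y.2 • VF c) *
        (η (WithLp.toLp 2 (pF c + y.1 • UF c + y.2 • VF c))) i) =
        S.indicator (fun y => (η (c.2 • c.1 + y.1 • U c + y.2 • V c)) i) := by
      funext y
      by_cases hy : c.2 • c.1 + y.1 • U c + y.2 • V c ∈ P
      · rw [Set.indicator_of_mem ((hmemP y).2 hy), Set.indicator_of_mem (show y ∈ S from hy), one_mul, hΦ]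
      · rw [Set.indicator_of_notMem (fun h => hy ((hmemP y).1 h)),
          Set.indicator_of_notMem (show y ∉ S from hy), zero_mul]
    rw [hind, integrable_indicator_iff hSmeas]
    exact (((PiLp.continuous_apply 2 _ i).comp hη.continuous).comp hΦc).continuousOn.integrableOn_compact
      hScpt
  -- merge the coordinate sum into the inner product
  have hsum : ∑ i, a c i * ∫ y : ℝ × ℝ,
      {x : Fin 3 → ℝ | ∀ c ∈ J, ∑ l, a c l * x l ≤ b c}.indicator (fun _ => (1 : ℝ))
        (pF c + y.1 • UF c + y.2 • VF c) * (η (WithLp.toLp 2 (pF c + y.1 • UF c + y.2 • VF c))) i =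
      ∫ y : ℝ × ℝ, S.indicator (fun y => ⟪η (c.2 • c.1 + y.1 • U c + y.2 • V c), c.1⟫) y := by
    have : ∀ y : ℝ × ℝ, ∑ i, a c i *
        ({x : Fin 3 → ℝ | ∀ c ∈ J, ∑ l, a c l * x l ≤ b c}.indicator (fun _ => (1 : ℝ))
          (pF c + y.1 • UF c + y.2 • VF c) * (η (WithLp.toLp 2 (pF c + y.1 • UF c + y.2 • VF c))) i) =
        S.indicator (fun y => ⟪η (c.2 • c.1 + y.1 • U c + y.2 • V c), c.1⟫) y := by
      intro y
      by_cases hy : c.2 • c.1 + y.1 • U c + y.2 • V c ∈ P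
      · rw [Set.indicator_of_mem (show y ∈ S from hy), real_inner_comm, inner_eq_sum_mul_three]
        refine Finset.sum_congr rfl fun i _ => ?_
        rw [Set.indicator_of_mem ((hmemP y).2 hy), one_mul, hΦ, ha]
      · rw [Set.indicator_of_notMem (show y ∉ S from hy)]
        refine Finset.sum_eq_zero fun i _ => ?_
        rw [Set.indicator_of_notMem (fun h => hy ((hmemP y).1 h)), zero_mul, mul_zero]
    have hstep : ∑ i, a c i * ∫ y : ℝ × ℝ,
        {x : Fin 3 → ℝ | ∀ c ∈ J, ∑ l, a c l * x l ≤ b c}.indicator (fun _ => (1 : ℝ))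
          (pF c + y.1 • UF c + y.2 • VF c) * (η (WithLp.toLp 2 (pF c + y.1 • UF c + y.2 • VF c))) i =
        ∑ i, ∫ y : ℝ × ℝ, a c i *
          ({x : Fin 3 → ℝ | ∀ c ∈ J, ∑ l, a c l * x l ≤ b c}.indicator (fun _ => (1 : ℝ))
            (pF c + y.1 • UF c + y.2 • VF c) * (η (WithLp.toLp 2 (pF c + y.1 • UF c + y.2 • VF c))) i) :=
      Finset.sum_congr rfl fun i _ => (integral_const_mul _ _).symm
    rw [hstep, ← integral_finsetSum _ (fun i _ => (hfi i).const_mul (a c i))]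
    exact integral_congr_ae (Filter.Eventually.of_forall this)
  rw [hsum, integral_indicator hSmeas]
  -- Step 5: closed facet preimage = open facet preimage a.e. (tie lines are null)
  refine setIntegral_congr_set ((ae_eq_set).2 ⟨?_, ?_⟩)
  · -- `S \ Φ⁻¹(open facet)` lies in the finite union of tie lines
    have hplane : ∀ y : ℝ × ℝ, ⟪c.1, c.2 • c.1 + y.1 • U c + y.2 • V c⟫ = c.2 :=
      fun y => inner_chart_base_eq (U c) (V c) c.1 c.2 (h1 c hc) (haU c hc) (haV c hc) y
    have hcover : S \ (fun y : ℝ × ℝ => c.2 • c.1 + y.1 • U c + y.2 • V c) ⁻¹'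
          {x | ⟪c.1, x⟫ = c.2 ∧ ∀ c' ∈ J, c' ≠ c → ⟪c'.1, x⟫ < c'.2} ⊆
        ⋃ c' ∈ J.erase c, {y : ℝ × ℝ | ∑ l, a c' l * (pF c + y.1 • UF c + y.2 • VF c) l = b c'} := by
      intro y hy
      obtain ⟨hyS, hyO⟩ := hy
      simp only [mem_preimage, mem_setOf_eq, not_and, not_forall] at hyO
      obtain ⟨c', hc', hc'c, hlt⟩ := hyO (hplane y)
      have hle : ⟪c'.1, c.2 • c.1 + y.1 • U c + y.2 • V c⟫ ≤ c'.2 := by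
        have hyP : c.2 • c.1 + y.1 • U c + y.2 • V c ∈ P := hyS
        rw [hP] at hyP
        simp only [mem_iInter, mem_setOf_eq] at hyP
        exact hyP c' hc'
      have heq : ⟪c'.1, c.2 • c.1 + y.1 • U c + y.2 • V c⟫ = c'.2 := le_antisymm hle (not_lt.1 hlt)
      refine Set.mem_biUnion (Finset.mem_erase.2 ⟨hc'c, hc'⟩) ?_
      show ∑ l, a c' l * (pF c + y.1 • UF c + y.2 • VF c) l = b c'
      simp only [ha, hb]
      rw [← heq, ← hΦ y, inner_eq_sum_mul_three]
    refine measure_mono_null hcover ?_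
    refine (measure_biUnion_null_iff (J.erase c).countable_toSet).2 fun c' hc' => ?_
    have hc'' := Finset.mem_erase.1 hc'
    exact volume_chartTieSet_eq_zero (a c) (a c') (pF c) (UF c) (VF c) (b c) (b c') (ha1 c hc)
      (hnd' c hc c' hc''.2 (Ne.symm hc''.1)) (hp c hc) (hU c hc) (hV c hc) (hU1' c hc) (hV1' c hc)
      (hUV' c hc)
  · -- the open facet lies in `P`
    have hsub : (fun y : ℝ × ℝ => c.2 • c.1 + y.1 • U c + y.2 • V c) ⁻¹'
        {x | ⟪c.1, x⟫ = c.2 ∧ ∀ c' ∈ J, c' ≠ c → ⟪c'.1, x⟫ < c'.2} ⊆ S := by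
      intro y hy
      exact openFacet_subset_closedHPolytope J hy
    rw [Set.sdiff_eq_empty.2 hsub, measure_empty]


/-- **Non-proportional planes meet a facet chart in a null set.**  For the chart
`Φ y = c.2 • c.1 + y₁U + y₂V` of the plane `⟪c.1, x⟫ = c.2` (`(U, V, c.1)` orthonormal) and a
constraint `c'` not proportional to `c`: `|Φ⁻¹ {⟪c'.1, x⟫ = c'.2}| = 0` (a line, or empty).
[cite: EvansGariepy2015, Thm 5.16 (Gauss–Green), polyhedral case — plumbing] -/
theorem volume_chartPreimage_plane_eq_zero (c c' : EuclideanSpace ℝ (Fin 3) × ℝ)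
    (U V : EuclideanSpace ℝ (Fin 3)) (h1 : ‖c.1‖ = 1) (hU1 : ‖U‖ = 1) (hV1 : ‖V‖ = 1)
    (hUV : ⟪U, V⟫ = 0) (haU : ⟪c.1, U⟫ = 0) (haV : ⟪c.1, V⟫ = 0)
    (hnp : ¬ ∃ μ : ℝ, c'.1 = μ • c.1 ∧ c'.2 = μ * c.2) :
    volume ((fun y : ℝ × ℝ => c.2 • c.1 + y.1 • U + y.2 • V) ⁻¹'
      {x : EuclideanSpace ℝ (Fin 3) | ⟪c'.1, x⟫ = c'.2}) = 0 := by
  have hset : (fun y : ℝ × ℝ => c.2 • c.1 + y.1 • U + y.2 • V) ⁻¹'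
      {x : EuclideanSpace ℝ (Fin 3) | ⟪c'.1, x⟫ = c'.2} =
      {y : ℝ × ℝ | ∑ l, (fun l => c'.1 l) l *
        ((fun l => c.2 * c.1 l) + y.1 • (fun l => U l) + y.2 • (fun l => V l)) l = c'.2} := by
    ext y
    rw [mem_preimage, mem_setOf_eq, mem_setOf_eq, ← toLp_chart_eq c U V y, inner_eq_sum_mul_three]
  rw [hset]
  refine volume_chartTieSet_eq_zero (fun l => c.1 l) (fun l => c'.1 l) (fun l => c.2 * c.1 l)
    (fun l => U l) (fun l => V l) c.2 c'.2 ?_ ?_ ?_ ?_ ?_ ?_ ?_ ?_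
  · rw [← norm_sq_eq_sum_sq_coord, h1, one_pow]
  · rintro ⟨μ, hμ, hμb⟩
    exact hnp ⟨μ, by ext l; simpa using hμ l, hμb⟩
  · have : ∑ l, c.1 l * (c.2 * c.1 l) = c.2 * ∑ l, c.1 l ^ 2 := by
      rw [Finset.mul_sum]; exact Finset.sum_congr rfl fun l _ => by ring
    rw [this, ← norm_sq_eq_sum_sq_coord, h1, one_pow, mul_one]
  · rw [← inner_eq_sum_mul_three]; exact haU
  · rw [← inner_eq_sum_mul_three]; exact haV
  · rw [← norm_sq_eq_sum_sq_coord, hU1, one_pow]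
  · rw [← norm_sq_eq_sum_sq_coord, hV1, one_pow]
  · rw [← inner_eq_sum_mul_three]; exact hUV

/-- `‖y₁U + y₂V‖² = y₁² + y₂²` for an orthonormal pair. [cite: EvansGariepy2015, Thm 5.16 — plumbing] -/
theorem norm_sq_chart_lateral (U V : EuclideanSpace ℝ (Fin 3)) (hU1 : ‖U‖ = 1) (hV1 : ‖V‖ = 1)
    (hUV : ⟪U, V⟫ = 0) (y : ℝ × ℝ) : ‖y.1 • U + y.2 • V‖ ^ 2 = y.1 ^ 2 + y.2 ^ 2 := by
  rw [← real_inner_self_eq_norm_sq, inner_add_left, inner_add_right, inner_add_right,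
    inner_smul_left, inner_smul_left, inner_smul_right, inner_smul_right, inner_smul_left,
    inner_smul_left, inner_smul_right, inner_smul_right, real_inner_self_eq_norm_sq,
    real_inner_self_eq_norm_sq, hU1, hV1, hUV, real_inner_comm U V, hUV]
  simp; ring

/-- The chart preimage of a BOUNDED set is bounded. [cite: EvansGariepy2015, Thm 5.16 — plumbing] -/
theorem isBounded_chartPreimage (c : EuclideanSpace ℝ (Fin 3) × ℝ) (U V : EuclideanSpace ℝ (Fin 3))
    (hU1 : ‖U‖ = 1) (hV1 : ‖V‖ = 1) (hUV : ⟪U, V⟫ = 0) {A : Set (EuclideanSpace ℝ (Fin 3))}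
    (hA : Bornology.IsBounded A) :
    Bornology.IsBounded ((fun y : ℝ × ℝ => c.2 • c.1 + y.1 • U + y.2 • V) ⁻¹' A) := by
  obtain ⟨R, hR⟩ := hA.subset_closedBall 0
  refine (Metric.isBounded_closedBall (x := (0 : ℝ × ℝ)) (r := R + ‖c.2 • c.1‖)).subset fun y hy => ?_
  have hy' : ‖c.2 • c.1 + y.1 • U + y.2 • V‖ ≤ R := by simpa using hR hy
  have hlat : ‖y.1 • U + y.2 • V‖ ≤ R + ‖c.2 • c.1‖ := by
    have : y.1 • U + y.2 • V = (c.2 • c.1 + y.1 • U + y.2 • V) - c.2 • c.1 := by abel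
    rw [this]
    exact (norm_sub_le _ _).trans (by linarith)
  have hsq := norm_sq_chart_lateral U V hU1 hV1 hUV y
  have h0 : 0 ≤ R + ‖c.2 • c.1‖ := (norm_nonneg _).trans hlat
  rw [mem_closedBall_zero_iff, Prod.norm_def, max_le_iff, Real.norm_eq_abs, Real.norm_eq_abs]
  constructor <;> nlinarith [sq_abs y.1, sq_abs y.2, sq_nonneg y.1, sq_nonneg y.2, norm_nonneg (y.1 • U + y.2 • V)]

/-- The chart preimage of a COMPACT set is compact. [cite: EvansGariepy2015, Thm 5.16 — plumbing] -/
theorem isCompact_chartPreimage (c : EuclideanSpace ℝ (Fin 3) × ℝ) (U V : EuclideanSpace ℝ (Fin 3))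
    (hU1 : ‖U‖ = 1) (hV1 : ‖V‖ = 1) (hUV : ⟪U, V⟫ = 0) {A : Set (EuclideanSpace ℝ (Fin 3))}
    (hA : IsCompact A) :
    IsCompact ((fun y : ℝ × ℝ => c.2 • c.1 + y.1 • U + y.2 • V) ⁻¹' A) :=
  Metric.isCompact_of_isClosed_isBounded (hA.isClosed.preimage (by fun_prop))
    (isBounded_chartPreimage c U V hU1 hV1 hUV hA.isBounded)

/-- The open facet as plane ∩ open polytope of the other constraints. [cite: Rockafellar1970, §6 Thm 6.3 — plumbing] -/
theorem openFacet_eq_inter (J : Finset (EuclideanSpace ℝ (Fin 3) × ℝ)) (c : EuclideanSpace ℝ (Fin 3) × ℝ) :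
    {x : EuclideanSpace ℝ (Fin 3) | ⟪c.1, x⟫ = c.2 ∧ ∀ c' ∈ J, c' ≠ c → ⟪c'.1, x⟫ < c'.2} =
      {x | ⟪c.1, x⟫ = c.2} ∩ ⋂ c' ∈ J.erase c, {x | ⟪c'.1, x⟫ < c'.2} := by
  ext x
  simp only [mem_setOf_eq, mem_inter_iff, mem_iInter, Finset.mem_erase, ne_eq, and_imp]
  exact ⟨fun h => ⟨h.1, fun c' hne hc' => h.2 c' hc' hne⟩, fun h => ⟨h.1, fun c' hc' hne => h.2 c' hne hc'⟩⟩

/-- The open facet is measurable. [cite: Rockafellar1970, §6 Thm 6.3 — plumbing] -/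
theorem measurableSet_openFacet (J : Finset (EuclideanSpace ℝ (Fin 3) × ℝ))
    (c : EuclideanSpace ℝ (Fin 3) × ℝ) :
    MeasurableSet {x : EuclideanSpace ℝ (Fin 3) | ⟪c.1, x⟫ = c.2 ∧ ∀ c' ∈ J, c' ≠ c → ⟪c'.1, x⟫ < c'.2} := by
  rw [openFacet_eq_inter]
  exact (isClosed_eq (continuous_const.inner continuous_id) continuous_const).measurableSet.inter
    (isOpen_openHPolytope (J.erase c)).measurableSet

/-- **Closed facet `=ᵐ` open facet in the chart.**  For `c ∈ J` (unit, pairwise non-proportional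
constraints) the chart preimage of the closed polyhedron `⋂ {⟪c'.1, x⟫ ≤ c'.2}` (equivalently of
the closed facet, the chart lying in the plane of `c`) and of the open facet differ by a null set
(finitely many tie lines). [cite: EvansGariepy2015, Thm 5.16 (Gauss–Green), polyhedral case — plumbing] -/
theorem chartPreimage_closedHPolytope_ae_eq_openFacet (J : Finset (EuclideanSpace ℝ (Fin 3) × ℝ))
    (h1 : ∀ c ∈ J, ‖c.1‖ = 1)
    (hnd : ∀ c ∈ J, ∀ c' ∈ J, c ≠ c' → ¬ ∃ μ : ℝ, c'.1 = μ • c.1 ∧ c'.2 = μ * c.2)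
    {c : EuclideanSpace ℝ (Fin 3) × ℝ} (hc : c ∈ J) (U V : EuclideanSpace ℝ (Fin 3))
    (hU1 : ‖U‖ = 1) (hV1 : ‖V‖ = 1) (hUV : ⟪U, V⟫ = 0) (haU : ⟪c.1, U⟫ = 0) (haV : ⟪c.1, V⟫ = 0) :
    ((fun y : ℝ × ℝ => c.2 • c.1 + y.1 • U + y.2 • V) ⁻¹'
        ⋂ c' ∈ J, {x : EuclideanSpace ℝ (Fin 3) | ⟪c'.1, x⟫ ≤ c'.2} : Set (ℝ × ℝ)) =ᵐ[volume]
      (fun y : ℝ × ℝ => c.2 • c.1 + y.1 • U + y.2 • V) ⁻¹'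
        {x | ⟪c.1, x⟫ = c.2 ∧ ∀ c' ∈ J, c' ≠ c → ⟪c'.1, x⟫ < c'.2} := by
  refine (ae_eq_set).2 ⟨?_, ?_⟩
  · have hplane : ∀ y : ℝ × ℝ, ⟪c.1, c.2 • c.1 + y.1 • U + y.2 • V⟫ = c.2 :=
      fun y => inner_chart_base_eq U V c.1 c.2 (h1 c hc) haU haV y
    have hcover : (fun y : ℝ × ℝ => c.2 • c.1 + y.1 • U + y.2 • V) ⁻¹'
          (⋂ c' ∈ J, {x : EuclideanSpace ℝ (Fin 3) | ⟪c'.1, x⟫ ≤ c'.2}) \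
        (fun y : ℝ × ℝ => c.2 • c.1 + y.1 • U + y.2 • V) ⁻¹'
          {x | ⟪c.1, x⟫ = c.2 ∧ ∀ c' ∈ J, c' ≠ c → ⟪c'.1, x⟫ < c'.2} ⊆
        ⋃ c' ∈ J.erase c, (fun y : ℝ × ℝ => c.2 • c.1 + y.1 • U + y.2 • V) ⁻¹'
          {x : EuclideanSpace ℝ (Fin 3) | ⟪c'.1, x⟫ = c'.2} := by
      intro y hy
      obtain ⟨hyP, hyO⟩ := hy
      simp only [mem_preimage, mem_iInter, mem_setOf_eq, not_and, not_forall] at hyP hyO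
      obtain ⟨c', hc', hc'c, hlt⟩ := hyO (hplane y)
      refine Set.mem_biUnion (Finset.mem_erase.2 ⟨hc'c, hc'⟩) ?_
      exact le_antisymm (hyP c' hc') (not_lt.1 hlt)
    refine measure_mono_null hcover ?_
    refine (measure_biUnion_null_iff (J.erase c).countable_toSet).2 fun c' hc' => ?_
    have hc'' := Finset.mem_erase.1 hc'
    exact volume_chartPreimage_plane_eq_zero c c' U V (h1 c hc) hU1 hV1 hUV haU haV
      (hnd c hc c' hc''.2 (Ne.symm hc''.1))
  · have hsub : (fun y : ℝ × ℝ => c.2 • c.1 + y.1 • U + y.2 • V) ⁻¹'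
          {x | ⟪c.1, x⟫ = c.2 ∧ ∀ c' ∈ J, c' ≠ c → ⟪c'.1, x⟫ < c'.2} ⊆
        (fun y : ℝ × ℝ => c.2 • c.1 + y.1 • U + y.2 • V) ⁻¹'
          ⋂ c' ∈ J, {x : EuclideanSpace ℝ (Fin 3) | ⟪c'.1, x⟫ ≤ c'.2} :=
      fun y hy => openFacet_subset_closedHPolytope J hy
    rw [Set.sdiff_eq_empty.2 hsub, measure_empty]

/-- **The facet formula for a bounded nonempty OPEN convex polytope in `ℝ³` (open facets, chart
areas):** `P_K(Q) = Σ_{c ∈ J} h_K(c.1) · |Φ_c⁻¹(open facet c)|` for every compact convex `K ∋ 0`.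
[cite: Maggi2012, (20.2) p. 258 and Remark 20.3; EvansGariepy2015, Thm 5.16 (Gauss–Green), polyhedral case] -/
theorem anisotropicPerimeter_openHPolytope_eq_facetSum (J : Finset (EuclideanSpace ℝ (Fin 3) × ℝ))
    (h1 : ∀ c ∈ J, ‖c.1‖ = 1)
    (hnd : ∀ c ∈ J, ∀ c' ∈ J, c ≠ c' → ¬ ∃ μ : ℝ, c'.1 = μ • c.1 ∧ c'.2 = μ * c.2)
    (hne : (⋂ c ∈ J, {x : EuclideanSpace ℝ (Fin 3) | ⟪c.1, x⟫ < c.2}).Nonempty)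
    (hbd : Bornology.IsBounded (⋂ c ∈ J, {x : EuclideanSpace ℝ (Fin 3) | ⟪c.1, x⟫ < c.2}))
    (U V : EuclideanSpace ℝ (Fin 3) × ℝ → EuclideanSpace ℝ (Fin 3))
    (hU1 : ∀ c ∈ J, ‖U c‖ = 1) (hV1 : ∀ c ∈ J, ‖V c‖ = 1) (hUV : ∀ c ∈ J, ⟪U c, V c⟫ = 0)
    (haU : ∀ c ∈ J, ⟪c.1, U c⟫ = 0) (haV : ∀ c ∈ J, ⟪c.1, V c⟫ = 0)
    {K : Set (EuclideanSpace ℝ (Fin 3))} (hKc : IsCompact K) (hK : Convex ℝ K)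
    (hK0 : (0 : EuclideanSpace ℝ (Fin 3)) ∈ K) :
    anisotropicPerimeter K (⋂ c ∈ J, {x : EuclideanSpace ℝ (Fin 3) | ⟪c.1, x⟫ < c.2}) =
      ENNReal.ofReal (∑ c ∈ J, sSup ((fun y => ⟪y, c.1⟫) '' K) *
        (volume ((fun y : ℝ × ℝ => c.2 • c.1 + y.1 • U c + y.2 • V c) ⁻¹'
          {x | ⟪c.1, x⟫ = c.2 ∧ ∀ c' ∈ J, c' ≠ c → ⟪c'.1, x⟫ < c'.2})).toReal) := by
  have hPc : IsCompact (⋂ c ∈ J, {x : EuclideanSpace ℝ (Fin 3) | ⟪c.1, x⟫ ≤ c.2}) :=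
    isCompact_closedHPolytope_of_isBounded J hne hbd
  refine anisotropicPerimeter_eq_facetSum_of_patches J
    (fun c y => c.2 • c.1 + y.1 • U c + y.2 • V c) (fun c _ => by fun_prop)
    (fun c => (fun y : ℝ × ℝ => c.2 • c.1 + y.1 • U c + y.2 • V c) ⁻¹'
      {x | ⟪c.1, x⟫ = c.2 ∧ ∀ c' ∈ J, c' ≠ c → ⟪c'.1, x⟫ < c'.2})
    (fun c _ => (measurableSet_openFacet J c).preimage
      (show Measurable (fun y : ℝ × ℝ => c.2 • c.1 + y.1 • U c + y.2 • V c) by fun_prop))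
    (fun c hc => ?_) (fun c => c.1) (fun c hc c' hc' hcc' => ?_) (fun η hη _ => ?_) hKc hK hK0
  · -- finiteness: the open facet preimage lies in the compact preimage of the closed polyhedron
    have hsub : (fun y : ℝ × ℝ => c.2 • c.1 + y.1 • U c + y.2 • V c) ⁻¹'
          {x | ⟪c.1, x⟫ = c.2 ∧ ∀ c' ∈ J, c' ≠ c → ⟪c'.1, x⟫ < c'.2} ⊆
        (fun y : ℝ × ℝ => c.2 • c.1 + y.1 • U c + y.2 • V c) ⁻¹'
          ⋂ c' ∈ J, {x : EuclideanSpace ℝ (Fin 3) | ⟪c'.1, x⟫ ≤ c'.2} :=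
      fun y hy => openFacet_subset_closedHPolytope J hy
    refine (lt_of_le_of_lt (measure_mono hsub) ?_).ne
    exact (isCompact_chartPreimage c (U c) (V c) (hU1 c hc) (hV1 c hc) (hUV c hc) hPc).measure_lt_top
  · -- separation of distinct open facets
    refine Disjoint.mono (image_preimage_subset _ _) (closure_mono (image_preimage_subset _ _)) ?_
    exact disjoint_openFacet_closure_openFacet J hc' (Ne.symm hcc')
  · exact setIntegral_fieldDivergence_openHPolytope_eq_facetSum J h1 hnd hne hbd U V hU1 hV1 hUV haU
      haV hη

end Literature.MeasureTheory.Integral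

end
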